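import Summits.Ventures.PercRepro.RankLevelSetUpNoQuad

/-! # RankLevelSetUpFiveDeletion — THE DELETION-AVERAGING STEP FOR (↑) AT LEVEL `5`: (↑)₅ ON EVERY `M ／ x` PLUS
THE COLOOP RESIDUE (P) GIVE (↑)₅ ON `M` (night-1 g40; dossier §52.7–52.9; on `RankLevelSetUpNoQuad`)

For a nonloop `x ∉ W`, `W` is bi-independent in `M ／ x` iff it is bi-independent in `M` with `x ∉ cl W`
(**`mem_biIndep_contract_iff`**). Summing (↑)₅ at `b` over the contractions `M ／ x`, `x ≠ b`, therefore gives
`Σ_{W ∈ T_5} (#E − 5 − c₀ W) ≤ Σ_{Z ∈ V_6} (#E − 7 − c₀' Z)` (**`sum_through_contract`**,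
**`sum_avoid_contract`**), where `c₀ W = #{t ∈ E ∖ W : t ∈ cl W}` (the coloops of `M✶ | (E ∖ W)`) and
`c₀' Z = #{t ∈ (E ∖ Z) ∖ {b} : t ∈ cl Z}`. The RESIDUE **`UpFiveDeletionResidue M b`** is the inequality
`Σ_{W ∈ T_5} c₀ W ≤ 2 · T_5 + Σ_{Z ∈ V_6} c₀' Z` (a `Prop`, NOT asserted; census 0 / 60,286 on rank-`5` duals with
planted long lines, parallel pairs and triples, kit j335435); it holds outright when every complement has `≤ 2`
coloops (**`upFiveDeletionResidue_of_bound_two`**), in particular when the dual is LINE-SPARSE — every set of rank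
`r ≤ 2` has `≤ r + 1` elements (**`ncard_coloops_add_three_le_of_lineSparse`**, **`LineSparse`**). Hence
**`upAt_five_of_contract_of_residue`**: `M` loopless, `b ∈ E`, `8 ≤ #E`, (↑)₅ at `b` on every `M ／ x` (`x ≠ b`)
and the residue ⟹ `BiIndepUpAt M b 5`. Every declaration has a docstring; imports: the cell's own modules and
Mathlib only. Axioms: standard. -/

namespace PercRepro

open Set Matroid Finset

variable {α : Type} (M : Matroid α) [M.Finite]

/-! ## Bi-independence in a single-element contraction -/

omit [M.Finite] in
/-- **For a nonloop `x`, `W ∈ biIndep (M ／ x) k ↔ W ∈ biIndep M k ∧ x ∉ W ∧ x ∉ cl W`.** -/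
lemma mem_biIndep_contract_iff {x : α} (hx : M.IsNonloop x) {W : Set α} {k : ℕ} :
    W ∈ biIndep (M.contract {x}) k ↔ W ∈ biIndep M k ∧ x ∉ W ∧ x ∉ M.closure W := by
  have hxE : x ∈ M.E := hx.mem_ground
  have hxi : M.Indep {x} := hx.indep
  simp only [biIndep, Set.mem_setOf_eq, Matroid.contract_ground]
  rw [hxi.contract_indep_iff, hxi.contract_indep_iff]
  constructor
  · rintro ⟨hWE, hWk, ⟨hdj, hWx⟩, ⟨-, hcx⟩⟩
    have hxW : x ∉ W := fun h => (Set.disjoint_left.mp hdj h) rfl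
    have hWi : M.Indep W := hWx.subset Set.subset_union_left
    have hins : M.Indep (insert x W) := by rwa [Set.union_singleton] at hWx
    have hxcl : x ∉ M.closure W := ((hWi.insert_indep_iff_of_notMem hxW).mp hins).2
    have hcompl : ((M.E \ {x}) \ W) ∪ {x} = M.E \ W := by
      ext y
      simp only [Set.mem_union, Set.mem_sdiff, Set.mem_singleton_iff]
      constructor
      · rintro (⟨⟨hyE, -⟩, hyW⟩ | rfl)
        · exact ⟨hyE, hyW⟩
        · exact ⟨hxE, hxW⟩
      · rintro ⟨hyE, hyW⟩
        by_cases hyx : y = x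
        · exact Or.inr hyx
        · exact Or.inl ⟨⟨hyE, hyx⟩, hyW⟩
    rw [hcompl] at hcx
    exact ⟨⟨fun y hy => (hWE hy).1, hWk, hWi, hcx⟩, hxW, hxcl⟩
  · rintro ⟨⟨hWE, hWk, hWi, hcompl⟩, hxW, hxcl⟩
    refine ⟨fun y hy => ⟨hWE hy, fun h => hxW (by rw [Set.mem_singleton_iff] at h; rw [← h]; exact hy)⟩, hWk,
      ⟨?_, ?_⟩, ⟨?_, ?_⟩⟩
    · rw [Set.disjoint_singleton_right]; exact hxW
    · rw [Set.union_singleton]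
      exact (hWi.insert_indep_iff_of_notMem hxW).mpr ⟨hxE, hxcl⟩
    · rw [Set.disjoint_singleton_right]
      intro h; exact h.1.2 rfl
    · have hcompl' : ((M.E \ {x}) \ W) ∪ {x} = M.E \ W := by
        ext y
        simp only [Set.mem_union, Set.mem_sdiff, Set.mem_singleton_iff]
        constructor
        · rintro (⟨⟨hyE, -⟩, hyW⟩ | rfl)
          · exact ⟨hyE, hyW⟩
          · exact ⟨hxE, hxW⟩
        · rintro ⟨hyE, hyW⟩
          by_cases hyx : y = x
          · exact Or.inr hyx
          · exact Or.inl ⟨⟨hyE, hyx⟩, hyW⟩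
      rw [hcompl']; exact hcompl

omit [M.Finite] in
/-- **The dual rank does not go up under the contraction of an element**: a base of `(M ／ x)✶ = M✶ ＼ x` is
independent in `M✶`. -/
lemma eRank_dual_contract_le (C : Set α) : (M.contract C)✶.eRank ≤ M✶.eRank := by
  obtain ⟨B, hB⟩ := (M.contract C)✶.exists_isBase
  rw [← hB.encard_eq_eRank]
  have hB' : (M.contract C)✶.Indep B := hB.indep
  rw [Matroid.dual_contract] at hB'
  exact hB'.of_delete.encard_le_eRank

omit [M.Finite] in
/-- The contraction of a single element of `E` has `#E − 1` elements. -/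
lemma ncard_ground_contract_singleton {x : α} (hx : x ∈ M.E) : (M.contract {x}).E.ncard = M.E.ncard - 1 := by
  rw [Matroid.contract_ground, Set.ncard_sdiff_singleton_of_mem hx]

/-! ## The families and the coloop counts -/

/-- The avoid-`b` family at level `k` is finite. -/
lemma avoid_finite (b : α) (k : ℕ) : {Z ∈ biIndep M k | b ∉ Z}.Finite :=
  (biIndep_finite M k).subset (fun _ h => h.1)

omit [M.Finite] in
/-- **THE COLOOP RESIDUE (P) OF THE DELETION-AVERAGING STEP AT LEVEL `5`** (night-1 g40; a `Prop`, NOT asserted):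
`Σ_{W ∈ T_5} #{t ∈ E ∖ W : t ∈ cl W} ≤ 2 · T_5 + Σ_{Z ∈ V_6} #{t ∈ (E ∖ Z) ∖ {b} : t ∈ cl Z}` — the coloops of the
complements of the through-`b` bi-independent `5`-sets, counted with multiplicity, are at most twice their number
plus the coloops (other than `b`) of the complements of the avoid-`b` bi-independent `6`-sets. Census: 0 failures
on 60,286 instances (kit j335435). -/
def UpFiveDeletionResidue (b : α) : Prop :=
  ∑ W ∈ (through_finite M b 5).toFinset, {t ∈ M.E \ W | t ∈ M.closure W}.ncard ≤
    2 * {W ∈ biIndep M 5 | b ∈ W}.ncard +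
      ∑ Z ∈ (avoid_finite M b 6).toFinset, {t ∈ (M.E \ Z) \ {b} | t ∈ M.closure Z}.ncard

/-- **The residue holds when every through-`b` complement has at most two coloops.** -/
lemma upFiveDeletionResidue_of_bound_two {b : α}
    (hbound : ∀ W ∈ biIndep M 5, b ∈ W → {t ∈ M.E \ W | t ∈ M.closure W}.ncard ≤ 2) :
    UpFiveDeletionResidue M b := by
  unfold UpFiveDeletionResidue
  have h1 : ∑ W ∈ (through_finite M b 5).toFinset, {t ∈ M.E \ W | t ∈ M.closure W}.ncard ≤
      ∑ W ∈ (through_finite M b 5).toFinset, 2 := by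
    refine Finset.sum_le_sum ?_
    intro W hW
    rw [Set.Finite.mem_toFinset] at hW
    exact hbound W hW.1 hW.2
  rw [Finset.sum_const, smul_eq_mul, ← Set.ncard_eq_toFinset_card _ (through_finite M b 5)] at h1
  omega

/-! ## Line-sparse duals -/

omit [M.Finite] in
/-- **`N` is line-sparse**: every set of rank `r ≤ 2` has at most `r + 1` elements — no parallel triple (rank `1`,
`≤ 2` elements) and no four points on a line (rank `2`, `≤ 3` elements). -/
def LineSparse (N : Matroid α) : Prop :=
  ∀ Y ⊆ N.E, N.eRk Y ≤ 2 → Y.encard ≤ N.eRk Y + 1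

/-- **A set `Y` of nonloops of rank `≤ ρ` with `≥ ρ + 2` elements in a line-sparse matroid has at most `ρ − 3`
coloops**: the non-coloops `Y' = Y ∖ C` have rank `rk Y − #C` and `#Y − #C` elements; if that rank were `≤ 2`,
line-sparseness would give `#Y ≤ rk Y + 1 ≤ ρ + 1`. -/
lemma ncard_coloops_add_three_le_of_lineSparse {N : Matroid α} [N.Finite] (hls : LineSparse N) {Y : Set α}
    (hYE : Y ⊆ N.E) {ρ : ℕ} (hρ : N.eRk Y ≤ ρ) (hY : ρ + 1 < Y.ncard) :
    {t ∈ Y | t ∉ N.closure (Y \ {t})}.ncard + 3 ≤ ρ := by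
  classical
  set C := {t ∈ Y | t ∉ N.closure (Y \ {t})} with hC
  have hYfin : Y.Finite := N.ground_finite.subset hYE
  have hCY : C ⊆ Y := fun t ht => ht.1
  have hCfin : C.Finite := hYfin.subset hCY
  set Y' := Y \ C with hY'
  have hsplit : Y = Y' ∪ ↑hCfin.toFinset := by
    rw [hCfin.coe_toFinset, Set.sdiff_union_of_subset hCY]
  have hsk : ∀ d ∈ hCfin.toFinset, d ∉ N.closure (Y' ∪ (↑hCfin.toFinset \ {d})) := by
    intro d hd
    rw [hCfin.mem_toFinset] at hd
    intro h
    apply hd.2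
    refine N.closure_subset_closure ?_ h
    rw [hCfin.coe_toFinset]
    intro x hx
    rcases hx with hx | hx
    · exact ⟨hx.1, fun h => hx.2 (by rw [Set.mem_singleton_iff] at h; rw [h]; exact hd)⟩
    · exact ⟨hCY hx.1, hx.2⟩
  have hrk : N.eRk Y = N.eRk Y' + (hCfin.toFinset.card : ℕ∞) := by
    rw [hsplit] at hρ ⊢
    exact eRk_union_eq_add_encard_of_forall_notMem_closure hCfin.toFinset
      (by rw [hCfin.coe_toFinset]; exact hCY.trans hYE) hsk
  have hCcard : hCfin.toFinset.card = C.ncard := (Set.ncard_eq_toFinset_card C hCfin).symm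
  have hY'card : Y'.ncard = Y.ncard - C.ncard := Set.ncard_sdiff hCY hCfin
  have hY'fin : Y'.Finite := hYfin.subset Set.sdiff_subset
  have hY'E : Y' ⊆ N.E := Set.sdiff_subset.trans hYE
  have hCle : C.ncard ≤ Y.ncard := Set.ncard_le_ncard hCY hYfin
  -- the rank of `Y'` is at least `3`
  have h3 : (3 : ℕ∞) ≤ N.eRk Y' := by
    by_contra hlt
    have hle2 : N.eRk Y' ≤ 2 := by
      have : N.eRk Y' < 3 := not_le.mp hlt
      rw [show (3 : ℕ∞) = 2 + 1 by norm_num] at this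
      exact Order.le_of_lt_add_one this
    have hls' := hls Y' hY'E hle2
    rw [hY'fin.encard_eq_coe_toFinset_card, ← Set.ncard_eq_toFinset_card _ hY'fin] at hls'
    -- `#Y = #Y' + #C ≤ rk Y' + 1 + #C = rk Y + 1 ≤ ρ + 1`
    have hYcard : ((Y.ncard : ℕ) : ℕ∞) = (Y'.ncard : ℕ∞) + (C.ncard : ℕ∞) := by
      rw [hY'card]; norm_cast; omega
    have hchain : ((Y.ncard : ℕ) : ℕ∞) ≤ (ρ : ℕ∞) + 1 := by
      calc ((Y.ncard : ℕ) : ℕ∞) = (Y'.ncard : ℕ∞) + (C.ncard : ℕ∞) := hYcard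
        _ ≤ (N.eRk Y' + 1) + (C.ncard : ℕ∞) := by gcongr
        _ = (N.eRk Y' + (hCfin.toFinset.card : ℕ∞)) + 1 := by rw [hCcard]; ring
        _ = N.eRk Y + 1 := by rw [hrk]
        _ ≤ ρ + 1 := by gcongr
    have : Y.ncard ≤ ρ + 1 := by exact_mod_cast hchain
    omega
  have h4 : ((C.ncard + 3 : ℕ) : ℕ∞) ≤ ρ := by
    calc ((C.ncard + 3 : ℕ) : ℕ∞) = (hCfin.toFinset.card : ℕ∞) + 3 := by rw [hCcard]; push_cast; ring
      _ ≤ (hCfin.toFinset.card : ℕ∞) + N.eRk Y' := by gcongr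
      _ = N.eRk Y := by rw [hrk, add_comm]
      _ ≤ ρ := hρ
  exact_mod_cast h4

/-- **On a matroid of nullity `≤ 5` with a line-sparse dual every bi-independent complement with `≥ 7` elements
has at most `2` coloops.** -/
lemma bound_two_of_lineSparse (hν : M✶.eRank ≤ 5) (hls : LineSparse M✶)
    {j : ℕ} {W : Set α} (hW : W ∈ biIndep M j) (hj : j + 7 ≤ M.E.ncard) :
    {t ∈ M.E \ W | t ∈ M.closure W}.ncard ≤ 2 := by
  rw [compl_closure_eq_dual_coloops M hW]
  have hYE : M.E \ W ⊆ M✶.E := by rw [Matroid.dual_ground]; exact Set.sdiff_subset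
  have hcard : (M.E \ W).ncard = M.E.ncard - j := by
    rw [Set.ncard_sdiff' hW.1 M.ground_finite, hW.2.1]
  have h := ncard_coloops_add_three_le_of_lineSparse hls hYE (ρ := 5) ((M✶.eRk_le_eRank _).trans hν) (by omega)
  omega

/-- **The residue (P) holds on a matroid of nullity `≤ 5` with a line-sparse dual and `≥ 12` elements.** -/
lemma upFiveDeletionResidue_of_lineSparse (hν : M✶.eRank ≤ 5) (hls : LineSparse M✶)
    (hn : 12 ≤ M.E.ncard) (b : α) : UpFiveDeletionResidue M b :=
  upFiveDeletionResidue_of_bound_two M (fun W hW _ => bound_two_of_lineSparse M hν hls hW (by omega))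

/-! ## The deletion-averaging step -/

omit [M.Finite] in
/-- **The through-`b` family of `M ／ x` at level `5`, read in `M`**: for a nonloop `x`,
`{W ∈ D_5(M ／ x) : b ∈ W} = {W ∈ T_5 : x ∉ W ∧ x ∉ cl W}`. -/
lemma through_contract_eq {x : α} (hx : M.IsNonloop x) (b : α) :
    {W ∈ biIndep (M.contract {x}) 5 | b ∈ W} = {W ∈ {W ∈ biIndep M 5 | b ∈ W} | x ∉ W ∧ x ∉ M.closure W} := by
  ext W
  simp only [Set.mem_setOf_eq, mem_biIndep_contract_iff M hx]
  tauto

omit [M.Finite] in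
/-- **The avoid-`b` family of `M ／ x` at level `6`, read in `M`**: for a nonloop `x`,
`{Z ∈ D_6(M ／ x) : b ∉ Z} = {Z ∈ V_6 : x ∉ Z ∧ x ∉ cl Z}`. -/
lemma avoid_contract_eq {x : α} (hx : M.IsNonloop x) (b : α) :
    {Z ∈ biIndep (M.contract {x}) 6 | b ∉ Z} = {Z ∈ {Z ∈ biIndep M 6 | b ∉ Z} | x ∉ Z ∧ x ∉ M.closure Z} := by
  ext Z
  simp only [Set.mem_setOf_eq, mem_biIndep_contract_iff M hx]
  tauto

/-- **The up-neighbours of a through-`b` member in the contractions**: for `W ∈ T_5`,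
`#{x ∈ E ∖ {b} : x ∉ W ∧ x ∉ cl W} = #E − 5 − c₀ W`. -/
lemma ncard_filter_through {b : α} {W : Set α} (hW : W ∈ biIndep M 5) (hbW : b ∈ W) :
    {x ∈ M.E \ {b} | x ∉ W ∧ x ∉ M.closure W}.ncard = M.E.ncard - 5 - {t ∈ M.E \ W | t ∈ M.closure W}.ncard := by
  have hEW : (M.E \ W).Finite := M.ground_finite.subset Set.sdiff_subset
  have hsub : {t ∈ M.E \ W | t ∈ M.closure W} ⊆ M.E \ W := fun t ht => ht.1
  have hcard : (M.E \ W).ncard = M.E.ncard - 5 := by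
    rw [Set.ncard_sdiff' hW.1 M.ground_finite, hW.2.1]
  rw [← hcard, ← Set.ncard_sdiff hsub (hEW.subset hsub)]
  congr 1
  ext x
  constructor
  · rintro ⟨⟨hxE, -⟩, hxW, hxcl⟩
    exact ⟨⟨hxE, hxW⟩, fun h => hxcl h.2⟩
  · rintro ⟨⟨hxE, hxW⟩, h⟩
    refine ⟨⟨hxE, fun hxb => hxW ?_⟩, hxW, fun hxcl => h ⟨⟨hxE, hxW⟩, hxcl⟩⟩
    rw [Set.mem_singleton_iff] at hxb
    rw [hxb]; exact hbW

/-- **The up-neighbours of an avoid-`b` member in the contractions**: for `Z ∈ V_6`,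
`#{x ∈ E ∖ {b} : x ∉ Z ∧ x ∉ cl Z} = #E − 7 − c₀' Z`. -/
lemma ncard_filter_avoid {b : α} (hb : b ∈ M.E) {Z : Set α} (hZ : Z ∈ biIndep M 6) (hbZ : b ∉ Z) :
    {x ∈ M.E \ {b} | x ∉ Z ∧ x ∉ M.closure Z}.ncard =
      M.E.ncard - 7 - {t ∈ (M.E \ Z) \ {b} | t ∈ M.closure Z}.ncard := by
  have hEZ : ((M.E \ Z) \ {b}).Finite := M.ground_finite.subset (Set.sdiff_subset.trans Set.sdiff_subset)
  have hsub : {t ∈ (M.E \ Z) \ {b} | t ∈ M.closure Z} ⊆ (M.E \ Z) \ {b} := fun t ht => ht.1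
  have hbEZ : b ∈ M.E \ Z := ⟨hb, hbZ⟩
  have hcard : ((M.E \ Z) \ {b}).ncard = M.E.ncard - 7 := by
    rw [Set.ncard_sdiff_singleton_of_mem hbEZ, Set.ncard_sdiff' hZ.1 M.ground_finite, hZ.2.1]
    omega
  rw [← hcard, ← Set.ncard_sdiff hsub (hEZ.subset hsub)]
  congr 1
  ext x
  constructor
  · rintro ⟨⟨hxE, hxb⟩, hxZ, hxcl⟩
    exact ⟨⟨⟨hxE, hxZ⟩, hxb⟩, fun h => hxcl h.2⟩
  · rintro ⟨⟨⟨hxE, hxZ⟩, hxb⟩, h⟩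
    exact ⟨⟨hxE, hxb⟩, hxZ, fun hxcl => h ⟨⟨⟨hxE, hxZ⟩, hxb⟩, hxcl⟩⟩

/-- **A double count**: for finite sets `A ⊆ α` and `B ⊆ Set α` and a relation `p`,
`Σ_{x ∈ A} #{W ∈ B : p x W} = Σ_{W ∈ B} #{x ∈ A : p x W}`. -/
lemma sum_ncard_comm {A : Set α} (hA : A.Finite) {B : Set (Set α)} (hB : B.Finite) (p : α → Set α → Prop) :
    ∑ x ∈ hA.toFinset, {W ∈ B | p x W}.ncard = ∑ W ∈ hB.toFinset, {x ∈ A | p x W}.ncard := by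
  classical
  have h1 : ∀ x, {W ∈ B | p x W}.ncard = (hB.toFinset.filter (fun W => p x W)).card := by
    intro x
    rw [← Set.ncard_coe_finset]
    congr 1
    ext W
    simp only [Finset.coe_filter, Set.Finite.mem_toFinset, Set.mem_setOf_eq]
  have h2 : ∀ W, {x ∈ A | p x W}.ncard = (hA.toFinset.filter (fun x => p x W)).card := by
    intro W
    rw [← Set.ncard_coe_finset]
    congr 1
    ext x
    simp only [Finset.coe_filter, Set.Finite.mem_toFinset, Set.mem_setOf_eq]
  simp only [h1, h2, Finset.card_filter]
  exact Finset.sum_comm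

/-- **THE SUM OF THE THROUGH-`b` COUNTS OVER THE CONTRACTIONS**: on a loopless `M`,
`Σ_{x ∈ E ∖ {b}} #{W ∈ D_5(M ／ x) : b ∈ W} = Σ_{W ∈ T_5} (#E − 5 − c₀ W)`. -/
lemma sum_through_contract (hloop : ∀ e, ¬ M.IsLoop e) (b : α) :
    ∑ x ∈ (M.ground_finite.subset (Set.sdiff_subset (t := {b}))).toFinset,
        {W ∈ biIndep (M.contract {x}) 5 | b ∈ W}.ncard =
      ∑ W ∈ (through_finite M b 5).toFinset, (M.E.ncard - 5 - {t ∈ M.E \ W | t ∈ M.closure W}.ncard) := by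
  have hstep : ∀ x ∈ (M.ground_finite.subset (Set.sdiff_subset (t := {b}))).toFinset,
      {W ∈ biIndep (M.contract {x}) 5 | b ∈ W}.ncard =
        {W ∈ {W ∈ biIndep M 5 | b ∈ W} | x ∉ W ∧ x ∉ M.closure W}.ncard := by
    intro x hx
    rw [Set.Finite.mem_toFinset] at hx
    have hxnl : M.IsNonloop x := Matroid.isNonloop_of_not_isLoop hx.1 (hloop x)
    rw [through_contract_eq M hxnl b]
  rw [Finset.sum_congr rfl hstep,
    sum_ncard_comm (M.ground_finite.subset (Set.sdiff_subset (t := {b}))) (through_finite M b 5)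
      (fun x W => x ∉ W ∧ x ∉ M.closure W)]
  refine Finset.sum_congr rfl ?_
  intro W hW
  rw [Set.Finite.mem_toFinset] at hW
  exact ncard_filter_through M hW.1 hW.2

/-- **THE SUM OF THE AVOID-`b` COUNTS OVER THE CONTRACTIONS**: on a loopless `M` with `b ∈ E`,
`Σ_{x ∈ E ∖ {b}} #{Z ∈ D_6(M ／ x) : b ∉ Z} = Σ_{Z ∈ V_6} (#E − 7 − c₀' Z)`. -/
lemma sum_avoid_contract (hloop : ∀ e, ¬ M.IsLoop e) {b : α} (hb : b ∈ M.E) :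
    ∑ x ∈ (M.ground_finite.subset (Set.sdiff_subset (t := {b}))).toFinset,
        {Z ∈ biIndep (M.contract {x}) 6 | b ∉ Z}.ncard =
      ∑ Z ∈ (avoid_finite M b 6).toFinset, (M.E.ncard - 7 - {t ∈ (M.E \ Z) \ {b} | t ∈ M.closure Z}.ncard) := by
  have hstep : ∀ x ∈ (M.ground_finite.subset (Set.sdiff_subset (t := {b}))).toFinset,
      {Z ∈ biIndep (M.contract {x}) 6 | b ∉ Z}.ncard =
        {Z ∈ {Z ∈ biIndep M 6 | b ∉ Z} | x ∉ Z ∧ x ∉ M.closure Z}.ncard := by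
    intro x hx
    rw [Set.Finite.mem_toFinset] at hx
    have hxnl : M.IsNonloop x := Matroid.isNonloop_of_not_isLoop hx.1 (hloop x)
    rw [avoid_contract_eq M hxnl b]
  rw [Finset.sum_congr rfl hstep,
    sum_ncard_comm (M.ground_finite.subset (Set.sdiff_subset (t := {b}))) (avoid_finite M b 6)
      (fun x Z => x ∉ Z ∧ x ∉ M.closure Z)]
  refine Finset.sum_congr rfl ?_
  intro Z hZ
  rw [Set.Finite.mem_toFinset] at hZ
  exact ncard_filter_avoid M hb hZ.1 hZ.2

/-- **(↑) AT LEVEL `5` FROM (↑) AT LEVEL `5` ON THE CONTRACTIONS `M ／ x` AND THE COLOOP RESIDUE** (`M` loopless,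
`b ∈ E`, `8 ≤ #E`): summing `T_5(M ／ x) ≤ V_6(M ／ x)` over `x ≠ b` gives
`(#E − 5) T_5 − Σ c₀ ≤ (#E − 7) V_6 − Σ c₀'`, and the residue `Σ c₀ ≤ 2 T_5 + Σ c₀'` turns it into
`(#E − 7) T_5 ≤ (#E − 7) V_6`. -/
theorem upAt_five_of_contract_of_residue (hloop : ∀ e, ¬ M.IsLoop e) {b : α} (hb : b ∈ M.E)
    (hn : 8 ≤ M.E.ncard) (hih : ∀ x ∈ M.E \ {b}, BiIndepUpAt (M.contract {x}) b 5)
    (hres : UpFiveDeletionResidue M b) : BiIndepUpAt M b 5 := by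
  unfold BiIndepUpAt
  unfold UpFiveDeletionResidue at hres
  show {W ∈ biIndep M 5 | b ∈ W}.ncard ≤ {Z ∈ biIndep M 6 | b ∉ Z}.ncard
  set Ef := (M.ground_finite.subset (Set.sdiff_subset (t := {b}))).toFinset with hEf
  set Tf := (through_finite M b 5).toFinset with hTf
  set Vf := (avoid_finite M b 6).toFinset with hVf
  set n := M.E.ncard with hn'
  -- the sums of the IH
  have hsum : ∑ x ∈ Ef, {W ∈ biIndep (M.contract {x}) 5 | b ∈ W}.ncard ≤
      ∑ x ∈ Ef, {Z ∈ biIndep (M.contract {x}) 6 | b ∉ Z}.ncard := by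
    refine Finset.sum_le_sum ?_
    intro x hx
    rw [hEf, Set.Finite.mem_toFinset] at hx
    exact hih x hx
  rw [sum_through_contract M hloop b, sum_avoid_contract M hloop hb] at hsum
  -- the counts of the families as finset cards
  have hT : Tf.card = {W ∈ biIndep M 5 | b ∈ W}.ncard := (Set.ncard_eq_toFinset_card _ (through_finite M b 5)).symm
  have hV : Vf.card = {Z ∈ biIndep M 6 | b ∉ Z}.ncard := (Set.ncard_eq_toFinset_card _ (avoid_finite M b 6)).symm
  -- the coloop counts are bounded by the sizes of the complements
  have hc₀ : ∀ W ∈ Tf, {t ∈ M.E \ W | t ∈ M.closure W}.ncard ≤ n - 5 := by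
    intro W hW
    rw [hTf, Set.Finite.mem_toFinset] at hW
    have h := Set.ncard_le_ncard (s := {t ∈ M.E \ W | t ∈ M.closure W}) (t := M.E \ W) (fun t ht => ht.1)
      (M.ground_finite.subset Set.sdiff_subset)
    rw [Set.ncard_sdiff' hW.1.1 M.ground_finite, hW.1.2.1] at h
    exact h
  have hc₀' : ∀ Z ∈ Vf, {t ∈ (M.E \ Z) \ {b} | t ∈ M.closure Z}.ncard ≤ n - 7 := by
    intro Z hZ
    rw [hVf, Set.Finite.mem_toFinset] at hZ
    have h := Set.ncard_le_ncard (s := {t ∈ (M.E \ Z) \ {b} | t ∈ M.closure Z}) (t := (M.E \ Z) \ {b})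
      (fun t ht => ht.1) (M.ground_finite.subset (Set.sdiff_subset.trans Set.sdiff_subset))
    have hbEZ : b ∈ M.E \ Z := ⟨hb, hZ.2⟩
    rw [Set.ncard_sdiff_singleton_of_mem hbEZ, Set.ncard_sdiff' hZ.1.1 M.ground_finite, hZ.1.2.1] at h
    exact h
  -- distribute the subtractions
  rw [Finset.sum_tsub_distrib _ hc₀, Finset.sum_tsub_distrib _ hc₀', Finset.sum_const, Finset.sum_const,
    smul_eq_mul, smul_eq_mul, hT, hV] at hsum
  have hS₁ : ∑ W ∈ Tf, {t ∈ M.E \ W | t ∈ M.closure W}.ncard ≤ Tf.card * (n - 5) := by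
    calc ∑ W ∈ Tf, {t ∈ M.E \ W | t ∈ M.closure W}.ncard ≤ ∑ W ∈ Tf, (n - 5) := Finset.sum_le_sum hc₀
      _ = Tf.card * (n - 5) := by rw [Finset.sum_const, smul_eq_mul]
  have hS₂ : ∑ Z ∈ Vf, {t ∈ (M.E \ Z) \ {b} | t ∈ M.closure Z}.ncard ≤ Vf.card * (n - 7) := by
    calc ∑ Z ∈ Vf, {t ∈ (M.E \ Z) \ {b} | t ∈ M.closure Z}.ncard ≤ ∑ Z ∈ Vf, (n - 7) := Finset.sum_le_sum hc₀'
      _ = Vf.card * (n - 7) := by rw [Finset.sum_const, smul_eq_mul]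
  rw [hT] at hS₁; rw [hV] at hS₂
  -- arithmetic: with `T := T_5`, `V := V_6`, `S₁`, `S₂`: `T (n−5) − S₁ ≤ V (n−7) − S₂`, `S₁ ≤ 2T + S₂` ⟹ `T ≤ V`
  set T := {W ∈ biIndep M 5 | b ∈ W}.ncard with hTdef
  set V := {Z ∈ biIndep M 6 | b ∉ Z}.ncard with hVdef
  set S₁ := ∑ W ∈ Tf, {t ∈ M.E \ W | t ∈ M.closure W}.ncard with hS₁def
  set S₂ := ∑ Z ∈ Vf, {t ∈ (M.E \ Z) \ {b} | t ∈ M.closure Z}.ncard with hS₂def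
  have e5 : T * (n - 5) = T * (n - 7) + 2 * T := by
    have : n - 5 = (n - 7) + 2 := by omega
    rw [this, Nat.mul_add]; ring
  have key : T * (n - 7) ≤ V * (n - 7) := by omega
  exact Nat.le_of_mul_le_mul_right key (by omega)

end PercRepro
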